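import Summits.ResolutionOfSingularities.ResolutionOfSingularities.Theorems.WeightedInvariantELadderTwoReadChart
import Summits.ResolutionOfSingularities.ResolutionOfSingularities.Theorems.WeightedInvariantELadderTwoMaxNonempty
import Summits.ResolutionOfSingularities.ResolutionOfSingularities.Theorems.WeightedInvariantHypersurfaceCentreAssemblyStalkDict
import Summits.ResolutionOfSingularities.ResolutionOfSingularities.Theorems.WeightedInvariantHypersurfaceLocalGameEFT4SDimLEDoorGradedHom
import HarnessLib

/-!
# Rung `e = 2`, piece (C-a) `E2MaxNonemptyBody` — (γ) `mu₂` IS ATTAINED; (C-a) under the graded HOM rung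

Cell `res-hironaka`, line `L W4.3`, door crux `HypersurfaceCentreConstruction` (stmt-ResolutionOfSingularities-19897),
E2 tier; registrar res-L1-w43-plan-1, SPEC (Δ9) rev 3/4, ORDER (o47-a) (res-D-pv-031).  OURS bookkeeping; nothing here
is a statement of [Hironaka2017]; AI-written, weaker than expert review.

* `Stage.exists_nhds_isClosed_superlevel` — **the graded chart reading**: under the rung `PRungGrHomLE 3 p ι J`
  ((c6) `IotaIsoInvariant`, (c12a) `IotaUnitInvariant`, (c8-gr)≤3 `IotaUpperSemicontinuousGradedLE 3 p ι`) and (I0)₂,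
  every `η ∈ genSing₂` has the torus-stable affine neighbourhood `D(t)` of `Stage.exists_readSection` on which the
  superlevel sets `{α ≤ iotaAt}` are closed IN `genSing₂`: `Γ(Y, D(t))` is a smooth `ℤʲ`-graded `k`-algebra with
  constants in degree `0` (`awayGrading`, …GradedChartBasicOpen; …ELadderTwoReadChart), ALL of whose homogeneous
  primes have local rings of dimension `≤ 3` (**G-HT** `LocalEngine.ght_holds`, …GradedHomogeneousHeight: units of
  the basis degrees on `D(t)` and `dim Γ(Y, D(t)) ≤ j + 3` by `GradedChart.ringKrullDim_le_of_minimalPrimes` +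
  `Stage.ringKrullDim_quotient_le_of_le_primeIdealOf`); on it `X = (F)` with `F` homogeneous, so
  `iotaAt ι X η' = ι(Γ(Y,D(t))_{𝔭(η')}, F)` (`LocalEngine.iotaAt_eq_iota_localization`) at every point, the points of
  `genSing₂` having HOMOGENEOUS primes (`isHomogeneous_primeIdealOf_basicOpen`); (c8-gr) gives the closed superlevel
  set in the homogeneous spectrum and `η' ↦ 𝔭(η')` is continuous;
* `Stage.isClosed_superlevel_genSing₂` — glued over the open cover of the subspace `genSing₂`;
* `Stage.exists_isMaxOn_iotaAt_genSing₂` — **(γ): `iotaAt` attains its supremum on the non-empty `genSing₂`** (the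
  subspace of the Noetherian `|Y|` is Noetherian; `exists_isMaxOn_of_isClosed_superlevel`, …IotaMaxStratum);
* `LocalEngine.e2MaxNonempty` — **(C-a) `E2MaxNonemptyBody p ι` under `PRungGrHomLE 3 p ι J`**
  (`e2MaxNonemptyBody_of_attained` + `Stage.genSing₂_nonempty`), i.e. the `ha` input of `stub_e2_centre_h_of_pieces`.
-/

noncomputable section

set_option linter.dupNamespace false -- mandated namespace of this single-conjunct summit

open CategoryTheory AlgebraicGeometry TopologicalSpace IsLocalRing
open Literature.AlgebraicGeometry.Resolution
open Summit.ResolutionOfSingularities.ResolutionOfSingularities.Theorems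
open Summit.ResolutionOfSingularities.ResolutionOfSingularities.Theorems.GradedChart
open Summit.ResolutionOfSingularities.ResolutionOfSingularities.Cruxes.HypersurfaceCentreConstruction.LocalEngine

namespace Summit.ResolutionOfSingularities.ResolutionOfSingularities.Theorems.ELadderOne.Stage

variable {k : Type} [Field k] (S : Stage k) {p : ℕ} (ι : (R : Type) → [CommRing R] → R → Ordinal.{0})
  (J : (R : Type) → [CommRing R] → R → ℕ → Ideal R)

/-- **The graded chart reading near a point of `genSing₂`.**  Under the graded HOM rung and (I0)₂, every
`η ∈ genSing₂` has an open neighbourhood `V` (the torus-stable basic open `D(t)` of `exists_readSection`) such that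
for every `α` the superlevel set `{η' ∈ V ∩ genSing₂ | α ≤ iotaAt ι X η'}` is closed in `V ∩ genSing₂`. [folklore] -/
theorem exists_nhds_isClosed_superlevel [CharP k p] [PerfectField k] (hr : PRungGrHomLE 3 p ι J)
    (h0 : S.InvDim₂) {η : S.Y} (hη : η ∈ S.genSing₂) (α : Ordinal.{0}) :
    ∃ V : S.Y.Opens, η ∈ V ∧
      IsClosed {w : {y : S.Y // y ∈ (V : Set S.Y) ∧ y ∈ S.genSing₂} | α ≤ iotaAt ι S.i.ker w.1} := by
  classical
  -- the rung clauses used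
  have hc6 : IotaIsoInvariant ι := hr.1.1
  have hu12 : IotaUnitInvariant ι := hr.1.2.2.2.2.2.2.2.2.1
  have hgr : IotaUpperSemicontinuousGradedLE 3 p ι := hr.2
  -- a unit chart through `η = i x`
  obtain ⟨x, rfl⟩ := mem_range_of_mem_singImage S hη.1
  obtain ⟨a, hxa, ha⟩ := S.exists_isUnitChart x
  letI := S.atlas.gradedRing a
  obtain ⟨hhom, -⟩ := hη.2.1 a ha hxa
  -- the read section `t` and the homogeneous local generator `F`
  obtain ⟨δ, t, F, ht, htP, hFh, hFI, hunits, ⟨g, hgt, hgmin⟩, ⟨g', hg't, hg'F⟩⟩ :=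
    S.exists_readSection a ha hxa ⟨x, rfl⟩
  have hW' : IsAffineOpen (S.Y.basicOpen t) := (S.atlas.W a).2.basicOpen t
  have hηV : S.i.base x ∈ S.Y.basicOpen t :=
    (mem_basicOpen_iff_not_mem_primeIdealOf (S.atlas.W a) hxa t).mpr htP
  refine ⟨S.Y.basicOpen t, hηV, ?_⟩
  -- the graded chart `Γ(Y, D(t))`
  set A : Type := (Γ(S.Y, S.Y.basicOpen t) : Type) with hA
  letI : Algebra k A := sectionsAlgebra S.kStr (S.Y.basicOpen t)
  haveI : Algebra.Smooth k A := S.smooth_sections ⟨S.Y.basicOpen t, hW'⟩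
  haveI : IsNoetherianRing A := S.isNoetherianRing_sections ⟨S.Y.basicOpen t, hW'⟩
  haveI := (S.atlas.W a).2.isLocalization_basicOpen t
  obtain ⟨instB⟩ := nonempty_gradedRing_awayGrading (S.atlas.W a) (S.atlas.piece a) ht
  letI := instB
  have hconst : ∀ c : k, algebraMap k A c ∈ awayGrading (S.atlas.W a) (S.atlas.piece a) ht 0 :=
    fun c => S.algebraMap_mem_awayGrading_zero a ht c
  -- units of the basis degrees and the dimension bound: G-HT
  have hunitsB : ∀ i : Fin S.j, ∃ u ∈ awayGrading (S.atlas.W a) (S.atlas.piece a) ht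
      (Pi.single i (S.atlas.exponent : ℤ)), IsUnit u := fun i => by
    obtain ⟨s, hs, hst⟩ := hunits i
    exact exists_isUnit_mem_awayGrading (S.atlas.W a) (S.atlas.piece a) ht hs hst
  have hdimA : ringKrullDim A ≤ ((S.j + 3 : ℕ) : WithBot ℕ∞) := by
    refine ringKrullDim_le_of_minimalPrimes (L := A) hgt fun Q hQ hgQ => ?_
    haveI : Q.IsPrime := hQ.1.1
    exact S.ringKrullDim_quotient_le_of_le_primeIdealOf h0 (S.atlas.W a) hη.1 hxa (hgmin Q hQ hgQ)
  have hGHT : ∀ P : PrimeSpectrum A, P.asIdeal.IsHomogeneous (awayGrading (S.atlas.W a) (S.atlas.piece a) ht) →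
      ringKrullDim (Localization.AtPrime P.asIdeal) ≤ ((3 : ℕ) : WithBot ℕ∞) := fun P hP =>
    ght_holds S.j 3 S.atlas.exponent S.atlas.exponent_pos A (awayGrading (S.atlas.W a) (S.atlas.piece a) ht)
      hunitsB hdimA P hP
  -- on `D(t)` the hypersurface is cut out by the homogeneous `F`
  set F' : A := algebraMap Γ(S.Y, S.atlas.W a) A F with hF'
  have hF'h : SetLike.IsHomogeneousElem (awayGrading (S.atlas.W a) (S.atlas.piece a) ht) F' := by
    obtain ⟨d, hd⟩ := hFh
    exact ⟨d, algebraMap_mem_awayGrading (S.atlas.W a) (S.atlas.piece a) ht hd⟩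
  have hXF : S.i.ker.ideal ⟨S.Y.basicOpen t, hW'⟩ = Ideal.span {F'} := by
    have h1 := S.i.ker.map_ideal_basicOpen (S.atlas.W a) t
    have h2 : (S.i.ker.ideal (S.atlas.W a)).map (algebraMap Γ(S.Y, S.atlas.W a) A) = Ideal.span {F'} :=
      map_eq_span_of_smul_le hFI hg'F (isUnit_algebraMap_of_dvd (S.atlas.W a) hg't)
    rw [← h2]
    exact h1.symm
  -- the (c8-gr) closed superlevel set in the homogeneous spectrum of `Γ(Y, D(t))`
  have hclosed := hgr k A S.j (awayGrading (S.atlas.W a) (S.atlas.piece a) ht) hconst hGHT F' hF'h α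
  -- the read points map continuously into the homogeneous spectrum
  let ψ : {y : S.Y // y ∈ (S.Y.basicOpen t : Set S.Y) ∧ y ∈ S.genSing₂} →
      {P : PrimeSpectrum A // P.asIdeal.IsHomogeneous (awayGrading (S.atlas.W a) (S.atlas.piece a) ht)} :=
    fun w => ⟨hW'.primeIdealOf ⟨w.1, w.2.1⟩, by
      -- the prime of an orbit-generic point is homogeneous on the unit chart, hence on `D(t)`
      have hwa : (w.1 : S.Y) ∈ (S.atlas.W a : S.Y.Opens) := S.Y.basicOpen_le t w.2.1
      obtain ⟨hwhom, -⟩ := w.2.2.2.1 a ha hwa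
      exact isHomogeneous_primeIdealOf_basicOpen (S.atlas.W a) (S.atlas.piece a) ht w.2.1 hwhom⟩
  have hψ : Continuous ψ := by
    refine Continuous.subtype_mk ?_ _
    have h1 : Continuous fun w : {y : S.Y // y ∈ (S.Y.basicOpen t : Set S.Y) ∧ y ∈ S.genSing₂} =>
        (⟨w.1, w.2.1⟩ : (S.Y.basicOpen t : S.Y.Opens)) := continuous_subtype_val.subtype_mk _
    exact hW'.isoSpec.hom.base.hom.continuous.comp h1
  -- the superlevel set is the preimage of the closed set
  have hset : {w : {y : S.Y // y ∈ (S.Y.basicOpen t : Set S.Y) ∧ y ∈ S.genSing₂} | α ≤ iotaAt ι S.i.ker w.1} =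
      ψ ⁻¹' {P | α ≤ ι (Localization.AtPrime P.1.asIdeal) (algebraMap A (Localization.AtPrime P.1.asIdeal) F')} := by
    ext w
    simp only [Set.mem_setOf_eq, Set.mem_preimage]
    rw [iotaAt_eq_iota_localization ι S.f hc6 hu12 S.i.ker (hy := w.2.1) hXF]
  rw [hset]
  exact hclosed.preimage hψ

/-- **The superlevel sets of `iotaAt` are closed in the subspace `genSing₂`** (glued from
`exists_nhds_isClosed_superlevel` over the open cover by the read charts). [folklore] -/
theorem isClosed_superlevel_genSing₂ [CharP k p] [PerfectField k] (hr : PRungGrHomLE 3 p ι J) (h0 : S.InvDim₂)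
    (α : Ordinal.{0}) : IsClosed {z : {y : S.Y // y ∈ S.genSing₂} | α ≤ iotaAt ι S.i.ker z.1} := by
  choose V hV hcl using fun z : {y : S.Y // y ∈ S.genSing₂} => S.exists_nhds_isClosed_superlevel ι J hr h0 z.2 α
  let U : {y : S.Y // y ∈ S.genSing₂} → Opens {y : S.Y // y ∈ S.genSing₂} :=
    fun z => (V z).comap ⟨Subtype.val, continuous_subtype_val⟩
  have hcov : IsOpenCover U := by
    refine IsOpenCover.mk (top_le_iff.mp fun z _ => ?_)
    exact Opens.mem_iSup.mpr ⟨z, hV z⟩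
  rw [hcov.isClosed_iff_coe_preimage]
  intro z
  let e : ↥(U z) → {y : S.Y // y ∈ (V z : Set S.Y) ∧ y ∈ S.genSing₂} :=
    fun w => ⟨w.1.1, w.2, w.1.2⟩
  have he : Continuous e := (continuous_subtype_val.comp continuous_subtype_val).subtype_mk _
  have hset : ((↑) ⁻¹' {z' : {y : S.Y // y ∈ S.genSing₂} | α ≤ iotaAt ι S.i.ker z'.1} : Set ↥(U z)) =
      e ⁻¹' {w | α ≤ iotaAt ι S.i.ker w.1} := rfl
  rw [hset]
  exact (hcl z).preimage he

/-- **(γ) ATTAINMENT: under the graded HOM rung and (I0)₂, `iotaAt` attains its supremum on the non-empty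
`genSing₂`** (the subspace of the Noetherian `|Y|` is Noetherian and the superlevel sets are closed in it).
[folklore] -/
theorem exists_isMaxOn_iotaAt_genSing₂ [CharP k p] [PerfectField k] (hr : PRungGrHomLE 3 p ι J)
    (h0 : S.InvDim₂) (hne : S.genSing₂.Nonempty) :
    ∃ η ∈ S.genSing₂, ∀ η' ∈ S.genSing₂, iotaAt ι S.i.ker η' ≤ iotaAt ι S.i.ker η := by
  haveI : NoetherianSpace S.Y := noetherianSpace_of_smooth_quasiCompact S.f
  haveI : NoetherianSpace {y : S.Y // y ∈ S.genSing₂} := inferInstance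
  obtain ⟨η₀, hη₀⟩ := hne
  obtain ⟨z₀, -, hmax⟩ := exists_isMaxOn_of_isClosed_superlevel
    (fun z : {y : S.Y // y ∈ S.genSing₂} => iotaAt ι S.i.ker z.1) (S.isClosed_superlevel_genSing₂ ι J hr h0)
    (S := Set.univ) ⟨⟨η₀, hη₀⟩, trivial⟩
  exact ⟨z₀.1, z₀.2, fun η' hη' => hmax ⟨η', hη'⟩ trivial⟩

end Summit.ResolutionOfSingularities.ResolutionOfSingularities.Theorems.ELadderOne.Stage

namespace Summit.ResolutionOfSingularities.ResolutionOfSingularities.Cruxes.HypersurfaceCentreConstruction.LocalEngine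

open Summit.ResolutionOfSingularities.ResolutionOfSingularities.Theorems.ELadderOne

/-- **(C-a) `E2MaxNonemptyBody p ι` UNDER THE GRADED HOM RUNG** — the `ha` input of `stub_e2_centre_h_of_pieces`
(SPEC (Δ9)): on a non-regular stage with (I0)₂ the maximum locus `maxLocus₂ ι` is non-empty
(`Stage.genSing₂_nonempty` + `Stage.exists_isMaxOn_iotaAt_genSing₂`). [OURS] -/
theorem e2MaxNonempty (p : ℕ) (ι : (R : Type) → [CommRing R] → R → Ordinal.{0})
    (J : (R : Type) → [CommRing R] → R → ℕ → Ideal R) (hr : PRungGrHomLE 3 p ι J) : E2MaxNonemptyBody p ι :=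
  e2MaxNonemptyBody_of_attained p ι fun _ _ _ _ S h0 hne => S.exists_isMaxOn_iotaAt_genSing₂ ι J hr h0 hne

/-- The same in the registrar's quantifier shape `∀ p, p.Prime → ∀ ι J, PRungGrHomLE 3 p ι J → E2MaxNonemptyBody p ι`
(the primality of `p` is not used). [OURS] -/
theorem e2MaxNonempty' : ∀ p : ℕ, p.Prime → ∀ (ι : (R : Type) → [CommRing R] → R → Ordinal.{0})
    (J : (R : Type) → [CommRing R] → R → ℕ → Ideal R), PRungGrHomLE 3 p ι J → E2MaxNonemptyBody p ι :=
  fun p _ ι J hr => e2MaxNonempty p ι J hr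

end Summit.ResolutionOfSingularities.ResolutionOfSingularities.Cruxes.HypersurfaceCentreConstruction.LocalEngine

end
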